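import Literature.RingTheory.FormalGroups.CocyclePolynomialFrobenius
import Mathlib.RingTheory.LocalRing.MaximalIdeal.Basic
import Mathlib.RingTheory.LocalRing.ResidueField.Basic
import HarnessLib

/-!
# Drinfeld's cocycles `(c, δ)` of degree `m` over an `𝒪`-module — the key lemma of [Drinfeld 1974] §1, part I
# ([Drinfeld 1974] §1, proof of Prop. 1.4 «Λ̃_𝒪^n ≅ 𝒪»; [Hazewinkel 1978] §21.4)

Topic `Literature/RingTheory/FormalGroups`; namespace `Literature.RingTheory.FormalGroups`.  One definition
(`IsDrinfeldCocycle`) + fully proved theorems; no named fact, no instance, no notation, no `sorry`.  Cell `hodgecm-mathlib`,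
P6 «MOD programme», sub-line P6d (`stub_L4B3cO`: formal `𝒪`-module laws lift along surjections — Drinfeld's road).

WHAT IS TYPED.  Comparing two formal `𝒪`-module laws `(F, ρ)`, `(F + Γ, ρ + δ·X^m)` that agree below degree `m` one finds, after
Lazard's symmetric 2-cocycle lemma `Γ = c · C_m` (siblings `SymmetricCocycle*`), a pair `(c, δ)` — `c` in the coefficient module
`N`, `δ : 𝒪 → N` — subject to DRINFELD'S RELATIONS
  `ν(m)·δ(a) = (a^m − a)·c`,  `δ(a+b) = δ(a) + δ(b) + C_m(a,b)·c`,  `δ(ab) = b^m·δ(a) + a·δ(b)`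
(from `[a]∘F = F∘([a]×[a])`, `[a+b] = F([a],[b])`, `[ab] = [a]∘[b]`).  This file: the structure `IsDrinfeldCocycle m c δ`, its
linearity, the STANDARD SOLUTIONS `(q_ν·d, a ↦ q(a)·d)` attached to an exact divisor `w` of `ν(m)` and of all `a^m − a`
(`isDrinfeldCocycle_of_div`; `w = 1` gives `(ν(m)·d, (a^m−a)·d)`), and the two EASY CLASSIFICATION CASES over a commutative
ring `𝒪`: `ν(m)` a unit (`exists_eq_standard_of_isUnit_lazardNu`), or some `u^m − u` a unit
(`exists_eq_standard_of_isUnit_pow_sub`) — every cocycle is standard.  The hard case (`𝒪` a DVR with finite residue field,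
`ν(m)` and all `u^m − u` in `𝔪`) and the LIFTING THEOREM are in the sibling `DrinfeldCocycleLift`.

Deliberately NOT here: power series (the translation bud ↔ cocycle is done in the bud files), the universal ring `Λ_𝒪`.
-/

namespace Literature.RingTheory.FormalGroups

open Finset

universe u v

variable {𝒪 : Type u} [CommRing 𝒪]

/-! ## §1 Drinfeld cocycles -/

/-- **Drinfeld cocycle of degree `m`** with values in an `𝒪`-module `N`: an element `c : N` (the multiple of `C_m` by which the
group law moves) and a map `δ : 𝒪 → N` (the degree-`m` coefficients by which the `𝒪`-action moves) satisfying Drinfeld's three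
relations `ν(m)·δ a = (a^m − a)·c`, `δ(a+b) = δ a + δ b + C_m(a,b)·c`, `δ(ab) = b^m·δ a + a·δ b`.
[cite: Drinfeld1974, §1 Prop. 1.4 (proof)] [cite: Hazewinkel1978, §21.4] -/
structure IsDrinfeldCocycle (m : ℕ) {N : Type v} [AddCommGroup N] [Module 𝒪 N] (c : N) (δ : 𝒪 → N) : Prop where
  /-- `ν(m)·δ(a) = (a^m − a)·c` -/
  nu_smul : ∀ a : 𝒪, lazardNu m • δ a = (a ^ m - a) • c
  /-- `δ(a+b) = δ(a) + δ(b) + C_m(a,b)·c` -/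
  delta_add : ∀ a b : 𝒪, δ (a + b) = δ a + δ b + cocyclePolyEval 𝒪 m a b • c
  /-- `δ(ab) = b^m·δ(a) + a·δ(b)` -/
  delta_mul : ∀ a b : 𝒪, δ (a * b) = b ^ m • δ a + a • δ b

namespace IsDrinfeldCocycle

variable {m : ℕ} {N : Type v} [AddCommGroup N] [Module 𝒪 N] {c c' : N} {δ δ' : 𝒪 → N}

/-- `(0, 0)` is a Drinfeld cocycle. [cite: Drinfeld1974, §1 Prop. 1.4 (proof)] -/
theorem zero (m : ℕ) : IsDrinfeldCocycle (𝒪 := 𝒪) m (0 : N) (fun _ => 0) where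
  nu_smul := fun a => by simp
  delta_add := fun a b => by simp
  delta_mul := fun a b => by simp

/-- Drinfeld cocycles form a subgroup: differences. [cite: Drinfeld1974, §1 Prop. 1.4 (proof)] -/
theorem sub (h : IsDrinfeldCocycle m c δ) (h' : IsDrinfeldCocycle m c' δ') :
    IsDrinfeldCocycle m (c - c') (fun a => δ a - δ' a) where
  nu_smul := fun a => by rw [smul_sub, h.nu_smul, h'.nu_smul, smul_sub]
  delta_add := fun a b => by rw [h.delta_add, h'.delta_add, smul_sub]; abel
  delta_mul := fun a b => by rw [h.delta_mul, h'.delta_mul, smul_sub, smul_sub]; abel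

/-- Drinfeld cocycles are preserved by `𝒪`-linear maps. [cite: Drinfeld1974, §1 Prop. 1.4 (proof)] -/
theorem map {N' : Type*} [AddCommGroup N'] [Module 𝒪 N'] (g : N →ₗ[𝒪] N') (h : IsDrinfeldCocycle m c δ) :
    IsDrinfeldCocycle m (g c) (fun a => g (δ a)) where
  nu_smul := fun a => by rw [← map_nsmul, h.nu_smul, map_smul]
  delta_add := fun a b => by rw [h.delta_add, map_add, map_add, map_smul]
  delta_mul := fun a b => by rw [h.delta_mul, map_add, map_smul, map_smul]

/-- `δ 0 = 0`. [cite: Drinfeld1974, §1 Prop. 1.4 (proof)] -/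
theorem apply_zero (h : IsDrinfeldCocycle m c δ) : δ 0 = 0 := by
  have := h.delta_mul 0 0
  simp only [mul_zero, zero_smul, add_zero] at this
  rcases Nat.eq_zero_or_pos m with rfl | hm
  · -- degree `0`: `δ 0 = δ 0 + 0`, use additivity instead
    have h2 := h.delta_add 0 0
    rw [add_zero, cocyclePolyEval_zero_right, zero_smul, add_zero] at h2
    simpa using h2
  · rw [zero_pow hm.ne', zero_smul] at this
    exact this

/-- `δ 1 = 0`. [cite: Drinfeld1974, §1 Prop. 1.4 (proof)] -/
theorem apply_one (h : IsDrinfeldCocycle m c δ) : δ 1 = 0 := by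
  have := h.delta_mul 1 1
  simp only [mul_one, one_pow, one_smul] at this
  -- this : δ 1 = δ 1 + δ 1
  have h2 : δ 1 + δ 1 = δ 1 + 0 := by rw [add_zero]; exact this.symm
  exact add_left_cancel h2

/-- The symmetric form of the multiplicativity relation: `(b^m − b)·δ a = (a^m − a)·δ b`. [cite: Drinfeld1974, §1 Prop. 1.4 (proof)] -/
theorem pow_sub_smul_comm (h : IsDrinfeldCocycle m c δ) (a b : 𝒪) : (b ^ m - b) • δ a = (a ^ m - a) • δ b := by
  have h1 := h.delta_mul a b
  have h2 := h.delta_mul b a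
  rw [mul_comm b a, h1] at h2
  -- h2 : b^m • δ a + a • δ b = a^m • δ b + b • δ a
  rw [sub_smul, sub_smul, sub_eq_sub_iff_add_eq_add]
  exact h2

/-- `δ (a·ϖ) = 0` as soon as `δ ϖ = 0` and `ϖ·δ a = 0`. [cite: Drinfeld1974, §1 Prop. 1.4 (proof)] -/
theorem apply_mul_eq_zero (h : IsDrinfeldCocycle m c δ) {ϖ a : 𝒪} (hϖ : δ ϖ = 0) (ha : ϖ • δ a = 0) : δ (ϖ * a) = 0 := by
  rw [h.delta_mul, hϖ, smul_zero, zero_add, ha]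

end IsDrinfeldCocycle

/-! ## §2 The standard solutions -/

/-- **The standard Drinfeld cocycles.**  Let `w ∈ 𝒪` be a non-zero-divisor dividing `ν(m)` and every `a^m − a`, with chosen
quotients `w·qν = ν(m)`, `w·q a = a^m − a`.  Then for every `d ∈ N` the pair `(qν·d, a ↦ q(a)·d)` is a Drinfeld cocycle:
the three relations, multiplied by `w`, are the binomial theorem `(a+b)^m = a^m + b^m + ν(m)·C_m(a,b)` and
`(ab)^m − ab = b^m(a^m − a) + a(b^m − b)`.  (`w = 1`: the family `(ν(m)·d, (a^m − a)·d)`; `w = ϖ^m − ϖ` in Drinfeld's hard case.)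
[cite: Drinfeld1974, §1 Prop. 1.4 (proof)] -/
theorem isDrinfeldCocycle_of_div {m : ℕ} (hm : 0 < m) {w qν : 𝒪} {q : 𝒪 → 𝒪} (hw : IsRegular w)
    (hqν : w * qν = lazardNu m) (hq : ∀ a, w * q a = a ^ m - a)
    {N : Type v} [AddCommGroup N] [Module 𝒪 N] (d : N) :
    IsDrinfeldCocycle m (qν • d) (fun a => q a • d) where
  nu_smul := fun a => by
    rw [smul_smul, ← Nat.cast_smul_eq_nsmul 𝒪, smul_smul]
    congr 1
    apply hw.left
    dsimp only
    rw [mul_left_comm, hq, mul_comm (a ^ m - a) qν, ← mul_assoc, hqν]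
  delta_add := fun a b => by
    rw [smul_smul, ← add_smul, ← add_smul]
    congr 1
    apply hw.left
    dsimp only
    have hab := add_pow_eq_add_lazardNu_mul_cocyclePolyEval hm a b
    rw [mul_add, mul_add, hq, hq, hq, mul_left_comm, hqν]
    linear_combination hab
  delta_mul := fun a b => by
    rw [smul_smul, smul_smul, ← add_smul]
    congr 1
    apply hw.left
    dsimp only
    rw [mul_add, hq, mul_left_comm, hq, mul_left_comm, hq]
    ring

/-- **The family `(ν(m)·d, (a^m − a)·d)`** is a Drinfeld cocycle for every `d`. [cite: Drinfeld1974, §1 Prop. 1.4 (proof)] -/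
theorem isDrinfeldCocycle_standard {m : ℕ} (hm : 0 < m) {N : Type v} [AddCommGroup N] [Module 𝒪 N] (d : N) :
    IsDrinfeldCocycle m ((lazardNu m : 𝒪) • d) (fun a : 𝒪 => (a ^ m - a) • d) :=
  isDrinfeldCocycle_of_div hm (q := fun a => a ^ m - a) isRegular_one (by rw [one_mul]) (fun a => by rw [one_mul]) d

/-! ## §3 The two easy cases of the classification -/

section Easy

variable {m : ℕ} {N : Type v} [AddCommGroup N] [Module 𝒪 N] {c : N} {δ : 𝒪 → N}

/-- **Case `ν(m)` a unit of `𝒪`** (e.g. `m` not a power of the residue characteristic): every Drinfeld cocycle is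
`(ν(m)·d, (a^m−a)·d)` with `d = ν(m)⁻¹·c`. [cite: Drinfeld1974, §1 Prop. 1.4 (proof)] -/
theorem IsDrinfeldCocycle.exists_eq_standard_of_isUnit_lazardNu (h : IsDrinfeldCocycle m c δ)
    (hν : IsUnit (lazardNu m : 𝒪)) : ∃ d : N, c = (lazardNu m : 𝒪) • d ∧ ∀ a, δ a = (a ^ m - a) • d := by
  obtain ⟨υ, hυ⟩ := hν.exists_left_inv
  refine ⟨υ • c, by rw [smul_smul, mul_comm, hυ, one_smul], fun a => ?_⟩
  rw [smul_comm, ← h.nu_smul a, ← Nat.cast_smul_eq_nsmul 𝒪, smul_smul, hυ, one_smul]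

/-- **Case some `u^m − u` a unit of `𝒪`** (e.g. `x ↦ x^m` is not the identity on the residue field): every Drinfeld cocycle
is `(ν(m)·d, (a^m−a)·d)` with `d = (u^m − u)⁻¹·δ u` (symmetric multiplicativity relation). [cite: Drinfeld1974, §1 Prop. 1.4 (proof)] -/
theorem IsDrinfeldCocycle.exists_eq_standard_of_isUnit_pow_sub (h : IsDrinfeldCocycle m c δ) {u : 𝒪}
    (hu : IsUnit (u ^ m - u)) : ∃ d : N, c = (lazardNu m : 𝒪) • d ∧ ∀ a, δ a = (a ^ m - a) • d := by
  obtain ⟨e, he⟩ := hu.exists_left_inv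
  refine ⟨e • δ u, ?_, fun a => ?_⟩
  · rw [smul_comm, Nat.cast_smul_eq_nsmul, h.nu_smul u, smul_smul, he, one_smul]
  · rw [smul_comm, ← h.pow_sub_smul_comm a u, smul_smul, he, one_smul]

end Easy

end Literature.RingTheory.FormalGroups
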